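import Literature.NumberTheory.GaloisRepresentations.GalLayerSystemHom
import Literature.NumberTheory.GaloisRepresentations.GalLayerSystemIdele
import HarnessLib

/-!
# The fundamental short exact sequence of the idèle class formation in the limit:
# `0 → lim→ Eˣ → J̄ → C̄ → 0` is short exact in the category `C_Γ` of discrete `Γ_F`-modules
# (Tate, C–F VII §8, §11.1; Harari §13.1; Milne, *ADT* I §4)

Topic `NumberTheory/GaloisRepresentations`; namespace `Literature.NumberTheory.GaloisRepresentations`.  Sequel to
`GalLayerSystemHom.lean` (door-c5 g16: morphisms of systems, `limitShortComplex_shortExact`) and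
`GalLayerSystemIdele.lean` (`unitsData`, `ideleData` with `J̄`, `classData` with `classBarD`).  Definitions with bodies
and theorems; NO named fact, no `sorry`, no instance, no notation.  Route A of crux `AnticycControlAdditiveK` (item 19295):
this is THE short exact sequence of discrete `Γ_F`-modules whose `Ext`-long exact sequence (door-c4's `Ext` in
`DiscreteRepCat ℤ Γ_F`) is the spine of Milne's proof of Poitou–Tate I 4.10 (the named fact `hE`).

Mathematics.  At every finite Galois layer `E/F` the sequence `1 → Eˣ → J_E → C_E → 1` is exact (principal idèles; tree
`ideleClassShortComplex_shortExact`), the maps are `Gal(E/F)`-equivariant (`IdeleHerbrand.principal_smul`) and compatible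
with the base changes (`AdeleRing.baseChange_algebraMap`, `classBaseChange_mk`).  They are therefore morphisms of Galois
layer systems `unitsData → ideleData → classData`, and since directed colimits are exact (`limitShortComplex_shortExact`)
the limit sequence `0 → lim→ Eˣ → J̄ → C̄ → 0` is short exact in `C_Γ` (Tate VII §11.1: passage to the limit over
the finite layers; Harari §13.1: `C = I/k̄ˣ`).  The third object is g15's `classBarD F` definitionally.

## What is formalised (`F : Type` a number field, `Γ = absoluteGaloisGroup F`)

* `unitsBarD F := (unitsData F).toSystem.toD` (`lim→ Eˣ`), **`ideleBarD F := (ideleData F).toSystem.toD`** (`J̄`) — objects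
  of `DiscreteRepCat ℤ Γ`.
* **`unitsToIdele F : (unitsData F).Hom (ideleData F)`** (principal idèles; `unitsToIdele_app_apply`, `_injective`),
  **`ideleToClass F : (ideleData F).Hom (classData F)`** (the class map; `ideleToClass_app_apply`, `_surjective`),
  `ideleToClass_unitsToIdele` (`= 0`), `exists_unitsToIdele_eq` (exactness at `J_E`).
* **`ideleClassLimitShortComplex F : ShortComplex (DiscreteRepCat ℤ Γ)`** with `X₁ = unitsBarD F`, `X₂ = ideleBarD F`,
  `X₃ = classBarD F` (`rfl` lemmas), and **`ideleClassLimitShortComplex_shortExact`**.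
* The maps on layers: `limitMap_unitsToIdele_of`, `limitMap_ideleToClass_of` (`[k]_E ↦ [(k)]_E`, `[x]_E ↦ [[x]]_E`).

## References
* J. W. S. Cassels, A. Fröhlich (eds.), *Algebraic Number Theory* (1967), Ch. VII (J. Tate) §8 (the sequence
  `1 → L* → J_L → C_L → 1`), §11.1. [CasselsFrohlichANT1967]
* D. Harari, *Galois Cohomology and Class Field Theory* (2020), §13.1. [Harari2020]
* J. S. Milne, *Arithmetic Duality Theorems* (2nd ed. 2006), I §4 (proof of Thm. 4.10). [MilneADT2006]
-/

noncomputable section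

open CategoryTheory CategoryTheory.Limits NumberField
open Field (absoluteGaloisGroup)
open Literature.Algebra.Homology
open Literature.NumberTheory.Automorphic Literature.NumberTheory.Automorphic.IdeleClassGroup
open Literature.NumberTheory.NumberFields
open scoped Classical

namespace Literature.NumberTheory.GaloisRepresentations

open IdeleClassBar

variable (F : Type) [Field F] [NumberField F]

/-- **`lim→ Eˣ` as an object of `C_Γ`** (it is `F̄ˣ`; the identification is the sequel file). [cite: Harari2020, §13.1] -/
abbrev unitsBarD : DiscreteRepCat ℤ (absoluteGaloisGroup F) := (unitsData F).toSystem.toD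

/-- **`J̄ = lim→ J_E` as an object of `C_Γ`** (Tate VII §9.7 `J_{K̄}`; Harari §13.1 `I`).
[cite: CasselsFrohlichANT1967, Ch. VII §9.7][cite: Harari2020, §13.1] -/
abbrev ideleBarD : DiscreteRepCat ℤ (absoluteGaloisGroup F) := (ideleData F).toSystem.toD

/-! ## The two morphisms of systems -/

/-- **Principal idèles `Eˣ → J_E` as a morphism of systems** (`IdeleHerbrand.principal`; equivariant by `principal_smul`,
compatible with base change by `AdeleRing.baseChange_algebraMap`).
[cite: CasselsFrohlichANT1967, Ch. VII §8 (the sequence `1 → L* → J_L → C_L → 1`)] -/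
def unitsToIdele : (unitsData F).Hom (ideleData F) where
  app E := haveI := E.numberField
    MonoidHom.toAdditive (α := (E.1)ˣ) (β := ideleGroup E.1) (IdeleHerbrand.principal E.1)
  app_ρ E g x := by
    haveI := E.numberField
    exact congrArg Additive.ofMul (IdeleHerbrand.principal_smul (F := F) g (Additive.toMul x : (E.1)ˣ))
  base_app E E' h x := by
    haveI := E.numberField
    haveI := E'.numberField
    letI := GalLayer.algebraOfLE h
    refine congrArg Additive.ofMul (Units.ext ?_)
    exact AdeleRing.baseChange_algebraMap E.1 E'.1 ((Additive.toMul x : (E.1)ˣ) : E.1)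

/-- Formula: `unitsToIdele` on a layer is `k ↦ (k)_𝔸`. [cite: CasselsFrohlichANT1967, Ch. VII §8] -/
theorem toMul_unitsToIdele_app (E : GalLayer F) (x : Additive (E.1)ˣ) :
    (haveI := E.numberField; (Additive.toMul ((unitsToIdele F).app E x) : ideleGroup E.1)) =
      (haveI := E.numberField; IdeleHerbrand.principal E.1 (Additive.toMul x : (E.1)ˣ)) := rfl

/-- **The class map `J_E → C_E` as a morphism of systems** (equivariant by definition of the action on classes,
compatible with base change by `classBaseChange_mk` and `transHom = baseChangeHom`).
[cite: CasselsFrohlichANT1967, Ch. VII §8 (the sequence `1 → L* → J_L → C_L → 1`)] -/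
def ideleToClass : (ideleData F).Hom (classData F) where
  app E := haveI := E.numberField
    MonoidHom.toAdditive (α := ideleGroup E.1) (β := IdeleClassGroup E.1) (QuotientGroup.mk' (principalIdeles E.1))
  app_ρ E g x := rfl
  base_app E E' h x := by
    change transHom E E' h _ = _
    rw [transHom_eq_baseChangeHom]
    rfl

/-- Formula: `ideleToClass` on a layer is `x ↦ [x]`. [cite: CasselsFrohlichANT1967, Ch. VII §8] -/
theorem toMul_ideleToClass_app (E : GalLayer F) (x : (ideleData F).V E) :
    (haveI := E.numberField; (Additive.toMul ((ideleToClass F).app E x) : IdeleClassGroup E.1)) =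
      (haveI := E.numberField; ((Additive.toMul x : ideleGroup E.1) : IdeleClassGroup E.1)) := rfl

/-! ## Exactness layer by layer -/

/-- `Eˣ → J_E` is injective. [cite: CasselsFrohlichANT1967, Ch. VII §8] -/
theorem unitsToIdele_injective (E : GalLayer F) : Function.Injective ((unitsToIdele F).app E) := fun x y hxy => by
  haveI := E.numberField
  exact (Additive.toMul (α := (E.1)ˣ)).injective
    (IdeleHerbrand.principal_injective (E := E.1) (congrArg (Additive.toMul (α := ideleGroup E.1)) hxy))

/-- `J_E → C_E` is onto. [cite: CasselsFrohlichANT1967, Ch. VII §8] -/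
theorem ideleToClass_surjective (E : GalLayer F) : Function.Surjective ((ideleToClass F).app E) := fun c => by
  haveI := E.numberField
  obtain ⟨y, hy⟩ := QuotientGroup.mk_surjective (Additive.toMul (α := IdeleClassGroup E.1) c)
  exact ⟨Additive.ofMul y, (congrArg Additive.ofMul hy).trans rfl⟩

/-- The class of a principal idèle is trivial: `J_E → C_E` kills `Eˣ`. [cite: CasselsFrohlichANT1967, Ch. VII §8] -/
theorem ideleToClass_unitsToIdele (E : GalLayer F) (x : (unitsData F).V E) :
    (ideleToClass F).app E ((unitsToIdele F).app E x) = 0 := by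
  haveI := E.numberField
  exact congrArg Additive.ofMul ((QuotientGroup.eq_one_iff _).mpr ⟨(Additive.toMul x : (E.1)ˣ), rfl⟩)

/-- Exactness at `J_E`: an idèle with trivial class is principal. [cite: CasselsFrohlichANT1967, Ch. VII §8] -/
theorem exists_unitsToIdele_eq (E : GalLayer F) (y : (ideleData F).V E) (hy : (ideleToClass F).app E y = 0) :
    ∃ x, (unitsToIdele F).app E x = y := by
  haveI := E.numberField
  have hy' : ((Additive.toMul y : ideleGroup E.1) : IdeleClassGroup E.1) = 1 :=
    congrArg (Additive.toMul (α := IdeleClassGroup E.1)) hy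
  obtain ⟨k, hk⟩ := (QuotientGroup.eq_one_iff _).mp hy'
  exact ⟨Additive.ofMul k, congrArg Additive.ofMul hk⟩

/-! ## The short exact sequence in `C_Γ` -/

/-- **`lim→ Eˣ → J̄ → C̄` as a short complex in `C_Γ = DiscreteRepCat ℤ Γ_F`.**
[cite: CasselsFrohlichANT1967, Ch. VII §11.1][cite: Harari2020, §13.1] -/
def ideleClassLimitShortComplex : ShortComplex (DiscreteRepCat ℤ (absoluteGaloisGroup F)) :=
  (unitsToIdele F).limitShortComplex (ideleToClass F) (ideleToClass_unitsToIdele F)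

/-- `X₁ = lim→ Eˣ`. [cite: Harari2020, §13.1] -/
theorem ideleClassLimitShortComplex_X₁ : (ideleClassLimitShortComplex F).X₁ = unitsBarD F := rfl

/-- `X₂ = J̄`. [cite: Harari2020, §13.1] -/
theorem ideleClassLimitShortComplex_X₂ : (ideleClassLimitShortComplex F).X₂ = ideleBarD F := rfl

/-- **`X₃ = C̄`** (g15's `classBarD F`, definitionally). [cite: Harari2020, §13.1] -/
theorem ideleClassLimitShortComplex_X₃ : (ideleClassLimitShortComplex F).X₃ = classBarD F := rfl

/-- `f = lim (principal idèles)`. [cite: Harari2020, §13.1] -/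
theorem ideleClassLimitShortComplex_f : (ideleClassLimitShortComplex F).f = (unitsToIdele F).limitHom := rfl

/-- `g = lim (class maps)`. [cite: Harari2020, §13.1] -/
theorem ideleClassLimitShortComplex_g : (ideleClassLimitShortComplex F).g = (ideleToClass F).limitHom := rfl

/-- **`0 → lim→ Eˣ → J̄ → C̄ → 0` is short exact in `C_Γ`** (layerwise `1 → Eˣ → J_E → C_E → 1`, Tate VII §8; exactness
of directed colimits). [cite: CasselsFrohlichANT1967, Ch. VII §8 and §11.1][cite: Harari2020, §13.1] -/
theorem ideleClassLimitShortComplex_shortExact : (ideleClassLimitShortComplex F).ShortExact :=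
  GalLayerData.Hom.limitShortComplex_shortExact (unitsToIdele F) (ideleToClass F) (ideleToClass_unitsToIdele F)
    (unitsToIdele_injective F) (ideleToClass_surjective F) (exists_unitsToIdele_eq F)

/-! ## The maps on layers -/

/-- `lim(principal) [k]_E = [(k)_𝔸]_E`. [cite: CasselsFrohlichANT1967, Ch. VII §8] -/
theorem limitMap_unitsToIdele_of (E : GalLayer F) (x : (unitsData F).V E) :
    (unitsToIdele F).limitMap ((unitsData F).toSystem.of E x) =
      (ideleData F).toSystem.of E ((unitsToIdele F).app E x) :=
  GalLayerData.Hom.limitMap_of _ E x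

/-- `lim(class) [x]_E = [[x]]_E` in `C̄ = classBar F` (`(classData F).toSystem.of E = ofLayer F E`).
[cite: CasselsFrohlichANT1967, Ch. VII §8] -/
theorem limitMap_ideleToClass_of (E : GalLayer F) (x : (ideleData F).V E) :
    (ideleToClass F).limitMap ((ideleData F).toSystem.of E x) = ofLayer F E ((ideleToClass F).app E x) :=
  GalLayerData.Hom.limitMap_of _ E x

/-- **`J̄ → C̄` is onto, `lim Eˣ → J̄` is injective, and `ker(J̄ → C̄) = im(lim Eˣ → J̄)`** (element form of the short
exactness). [cite: CasselsFrohlichANT1967, Ch. VII §8 and §11.1] -/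
theorem ideleToClass_limitMap_surjective : Function.Surjective (ideleToClass F).limitMap :=
  (ideleToClass F).limitMap_surjective (ideleToClass_surjective F)

/-- `lim Eˣ → J̄` is injective. [cite: CasselsFrohlichANT1967, Ch. VII §8 and §11.1] -/
theorem unitsToIdele_limitMap_injective : Function.Injective (unitsToIdele F).limitMap :=
  (unitsToIdele F).limitMap_injective (unitsToIdele_injective F)

/-- `ker(J̄ → C̄) ⊆ im(lim Eˣ → J̄)`. [cite: CasselsFrohlichANT1967, Ch. VII §8 and §11.1] -/
theorem exists_unitsToIdele_limitMap_eq (z : (ideleData F).toSystem.limit) (hz : (ideleToClass F).limitMap z = 0) :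
    ∃ w, (unitsToIdele F).limitMap w = z :=
  GalLayerData.Hom.exists_limitMap_eq_of_limitMap_eq_zero _ _ (exists_unitsToIdele_eq F) z hz

end Literature.NumberTheory.GaloisRepresentations

end
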